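import Mathlib
import Literature.MathematicalPhysics.QuantumFieldTheory.Balaban1983to89.B5Blocks16

/-!
# B5: the averaging constraint `Q′_kλ = 0` in momentum space ((1.30), second equation), the
# gauge invariance of `δ(B − Q_kA)` (p. 20), and `Q_k 1 = 1`, `⟨1, Q_kA_μ⟩ = ⟨1, A_μ⟩` ((1.74))

Source: T. Bałaban, *Propagators and renormalization transformations for lattice gauge
theories. I*, Commun. Math. Phys. 95 (1984) 17–40 (`Balaban1984PropagatorsI`, "B5"), renders
`b2b-balaban-ref1/pages/1984-cmp95-propagators-rt-I/…-pNNN-x2.png` (PDF page = journal page − 16),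
read as images.

## What the paper prints (verbatim)

* p. 20 [PDF 4], after (1.20): «or denoting (Q′_kλ)(y) = Σ_{x∈B^k(y)} η^dλ(x), we have
  Q_kA^λ = Q_kA − ∂Q′_kλ. The δ-function δ(B − Q_kA) is invariant with respect to gauge
  transformations λ satisfying Q′_kλ = 0».
* p. 23 [PDF 7], (1.30): «Δ²(p)λ̃(p) − Δ(p)(∂*A)~(p) + \overline{u_k(p)} ω̃(p′) = 0,
  Σ_l u_k(p′+l) λ̃(p′+l) = 0», with (1.31) «u_k(p) = Π_μ ∂¹_μ(p′)/∂_μ(p)» and «p ∈ T̃_η is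
  represented as a sum p = p′ + l, p′ ∈ T̃₁^{(k)} and l = (l₁,…,l_d), l_μ = 2πm_μ, m_μ is an
  integer».
* p. 30 [PDF 14], (1.74): «a⟨1, Q*QA_μ⟩ = a⟨1, A_μ⟩ = ⟨1, J_μ⟩, so ⟨1, A_μ⟩ = a⁻¹⟨1, J_μ⟩».

## What is typed and certified here (kernel-checked, zero sorry)

With the position-space operators of `B5Block118` (`QsOp` = Q′_k, `QvOp` = Q_k on the `η`-torus
`Tor (fine n M)`, unit lattice `Tor M`, fine momenta `p′ + l = pOf (k, q)`, `u = uSym` of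
`B5Prop11Fiber`) and the partition of `B5Blocks16`:
* `constraint_iff` — THE SECOND EQUATION OF (1.30) IS THE CONSTRAINT: `Q′_kλ = 0 ⟺
  ∀ p′, Σ_l u(p′+l) λ̂(p′+l) = 0` (from `dft_QsOp`, injectivity of the unitary DFT
  `dft_mulVec_eq_zero`, and `cQ ≠ 0`);
* `QvOp_gaugeT_of_constraint` — «δ(B − Q_kA) is invariant with respect to gauge transformations λ
  satisfying Q′_kλ = 0»: `Q′_kλ = 0 → Q_k(A^λ) = Q_kA`;
* `QvOp_const` — `Q_k c = c` for a constant field (`η^{d+1}·n^d·n = 1`), and `sum_QvOp` —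
  `Σ_{y∈T₁^{(k)}} (Q_kA)_{⟨y,y+e_μ⟩} = η^d Σ_{x∈T_η} A_μ(x)`, i.e. the pairing identity
  `⟨1, Q_kA_μ⟩_{T₁} = ⟨1, A_μ⟩_{T_η}` which, with `Q_k 1 = 1`, is the step «⟨1, Q*QA_μ⟩ = ⟨1, A_μ⟩»
  of (1.74) (the adjoint `Q*` being taken between the `η^d`-weighted pairing on `T_η` and the
  unweighted one on `T₁^{(k)}`).

## What is NOT certified here

The first equation of (1.30) (the variational equation with multiplier `ω`); the operator `Q*`
itself as a matrix and (1.76); everything else of Sect. E.  Fields complex (B5 real).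
-/

open scoped BigOperators Matrix ComplexConjugate
open Finset Complex

namespace Literature.MathematicalPhysics.QuantumFieldTheory.Balaban1983to89.B5Constraint130

open Literature.MathematicalPhysics.QuantumFieldTheory.Balaban1983to89.B5Prop11Fiber
open Literature.MathematicalPhysics.QuantumFieldTheory.Balaban1983to89.B5Prop11Plancherel
open Literature.MathematicalPhysics.QuantumFieldTheory.Balaban1983to89.B5Action121
open Literature.MathematicalPhysics.QuantumFieldTheory.Balaban1983to89.B5Block118
open Literature.MathematicalPhysics.QuantumFieldTheory.Balaban1983to89.B5Blocks16

noncomputable section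

section DFT

variable {d : ℕ} (N : Fin d → ℕ) [hN : ∀ μ, NeZero (N μ)]

/-- the unitary DFT has trivial kernel: `f̂ = 0 → f = 0`. [folklore] -/
theorem dft_mulVec_eq_zero (v : Tor N → ℂ) (h : dft N *ᵥ v = 0) : v = 0 := by
  have h1 : star (dft N) * dft N = 1 :=
    Matrix.mem_unitaryGroup_iff'.mp (dft_mem_unitaryGroup N)
  calc v = (star (dft N) * dft N) *ᵥ v := by rw [h1, Matrix.one_mulVec]
    _ = 0 := by rw [← Matrix.mulVec_mulVec, h, Matrix.mulVec_zero]

end DFT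

variable {d : ℕ} (n : ℕ) [NeZero n] (M : Fin d → ℕ) [hM : ∀ μ, NeZero (M μ)]

/-- `c = (√(n^d))⁻¹ ≠ 0`. [folklore] -/
theorem cQ_ne_zero : (cQ n M : ℂ) ≠ 0 := by
  have hn0 : (0 : ℝ) < n := by exact_mod_cast Nat.pos_of_ne_zero (NeZero.ne n)
  rw [cQ_eq]
  exact_mod_cast inv_ne_zero (Real.sqrt_ne_zero'.mpr (pow_pos hn0 d))

/-- (1.30), second equation = the averaging constraint in momentum space:
«Q′_kλ = 0» ⟺ «Σ_l u_k(p′+l) λ̃(p′+l) = 0» for every `p′ ∈ T̃₁^{(k)}`.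
[cite: Balaban1984PropagatorsI, (1.30) p.23] -/
theorem constraint_iff (l : Tor (fine n M) → ℂ) :
    QsOp n M *ᵥ l = 0 ↔
      ∀ q : Tor M, ∑ k : Fin d → Fin n,
        uSym n k (sOf M q) * (dft (fine n M) *ᵥ l) (pOf n M (k, q)) = 0 := by
  constructor
  · intro h q
    have h1 := dft_QsOp n M l q
    rw [h, Matrix.mulVec_zero, Pi.zero_apply] at h1
    exact (mul_eq_zero.mp h1.symm).resolve_left (cQ_ne_zero n M)
  · intro h
    apply dft_mulVec_eq_zero M
    funext q
    rw [dft_QsOp, h q, mul_zero, Pi.zero_apply]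

/-- p. 20: «The δ-function δ(B − Q_kA) is invariant with respect to gauge transformations λ
satisfying Q′_kλ = 0» — `Q′_kλ = 0 → Q_k(A^λ) = Q_kA`. [cite: Balaban1984PropagatorsI, (1.20) p.20] -/
theorem QvOp_gaugeT_of_constraint (A : Tor (fine n M) × Fin d → ℂ) (l : Tor (fine n M) → ℂ)
    (h : QsOp n M *ᵥ l = 0) :
    QvOp n M *ᵥ gaugeT (fine n M) (n : ℂ) A l = QvOp n M *ᵥ A := by
  rw [QvOp_gaugeT_eq, h, Matrix.mulVec_zero, sub_zero]

/-- `Q_k` of a constant field is that constant (`η^{d+1} · |B^k(y)| · n = 1`): `Q_k 1 = 1`.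
[cite: Balaban1984PropagatorsI, (1.18) p.20] -/
theorem QvOp_const (c : ℂ) : QvOp n M *ᵥ (fun _ => c) = fun _ => c := by
  have hnc : (n : ℂ) ≠ 0 := by exact_mod_cast NeZero.ne n
  funext b
  rcases b with ⟨y, μ⟩
  rw [QvOp_mulVec]
  simp only [lineSum, Finset.sum_const, Finset.card_univ, Fintype.card_fin, Fintype.card_pi,
    Finset.prod_const, nsmul_eq_mul]
  push_cast
  field_simp
  ring

/-- (1.74), the step «⟨1, Q*QA_μ⟩ = ⟨1, A_μ⟩» in position space:
`Σ_{y∈T₁^{(k)}} (Q_kA)_{⟨y,y+e_μ⟩} = η^d Σ_{x∈T_η} A_μ(x)` (the blocks partition `T_η`,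
`sum_blocks`, and each of the `n` translates `x ↦ x + tηe_μ` preserves `Σ_x`).
[cite: Balaban1984PropagatorsI, (1.74) p.30] -/
theorem sum_QvOp (A : Tor (fine n M) × Fin d → ℂ) (μ : Fin d) :
    ∑ y : Tor M, (QvOp n M *ᵥ A) (y, μ) = 1 / (n : ℂ) ^ d * ∑ x : Tor (fine n M), A (x, μ) := by
  have hnc : (n : ℂ) ≠ 0 := by exact_mod_cast NeZero.ne n
  have h1 : ∀ t : ℕ, ∑ y : Tor M, ∑ j : Fin d → Fin n,
      A (bpt n M y j + tstep (fine n M) μ t, μ) = ∑ x, A (x, μ) := by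
    intro t
    have hb := sum_blocks n M (fun x => A (x + tstep (fine n M) μ t, μ))
    rw [← hb]
    exact Fintype.sum_equiv (Equiv.addRight (tstep (fine n M) μ t)) _ _ (fun x => rfl)
  simp only [QvOp_mulVec, lineSum]
  rw [← Finset.mul_sum]
  have h2 : ∑ y : Tor M, ∑ j : Fin d → Fin n, ∑ t : Fin n,
      A (bpt n M y j + tstep (fine n M) μ t, μ) = (n : ℂ) * ∑ x, A (x, μ) := by
    rw [Finset.sum_congr rfl (fun y _ => Finset.sum_comm), Finset.sum_comm]
    simp only [h1, Finset.sum_const, Finset.card_univ, Fintype.card_fin, nsmul_eq_mul]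
  rw [h2]
  field_simp
  ring

end

end Literature.MathematicalPhysics.QuantumFieldTheory.Balaban1983to89.B5Constraint130
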